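import Literature.AlgebraicGeometry.AbelianSchemes.PolarizedTripleIsBaseChangeViaZariskiGlue
import Literature.AlgebraicGeometry.AbelianSchemes.PolarizedTripleIsBaseChangeViaFpqcLocal
import HarnessLib

/-!
# Pull-back data of polarised abelian schemes with level structure DESCEND along fpqc coverings

Layer `Literature/AlgebraicGeometry/AbelianSchemes`, namespace `Literature.AlgebraicGeometry.AbelianSchemes.PolarizedAbelianSchemeWithLevel`.
THEOREMS ONLY (no definition, no structure, no instance, no named fact, no `sorry`).  Cell `hodgecm-mathlib` (D-0151),
F-DAG hand (h7) sequel (P3), the fpqc twin of ★ `PolarizedTripleIsBaseChangeViaZariskiGlue` and the generic core of F-10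
(b2′)/(b3) («the relation `Y.IsBaseChangeVia X_Q f G Ĝ` for the DESCENDED classifying map»: there `c = T ×_Q M → T` is
finite étale surjective and `P` is the descended universal triple).  HC_CM is proved only modulo the 7 printed citations
until rung 0 closes; nothing here is about HC.

[MumfordFogartyKirwan1994, Ch. 7 §2 Proposition 7.6 (pp. 136–138)] / [Deligne1971TravauxShimura, 4.16]: for `n ≥ 3`
triples are rigid, so pull-back data are unique (★ `IsBaseChangeVia.unique_of_forall_geometricPoint`) and therefore
DESCEND ([GortzWedhorn2020, Thm. 14.72]: morphisms of schemes descend along fpqc coverings, ★ (δ)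
`exists_desc_of_pullback_comp_eq`).  THIS FILE, over a locally Noetherian `T` whose geometric points carry rigid triples
(the binder `hT` of ★ `PolarizedTripleRigidity`, verbatim) and an fpqc covering `c : T' → T` (flat, surjective,
quasi-compact) with `T' ×_T T'` locally Noetherian (a Mathlib instance when `c` is locally of finite type, e.g. finite
étale):

* **`exists_isBaseChangeVia_of_flat_surjective`** — if the restricted triple `P'|_{T'}` (★ `baseChange c`) is the
  pull-back of `P` along `T' → T → S` via SOME `(G', Ĝ')`, then `G'`, `Ĝ'` descend along the coverings
  `X' ×_T T' → X'`, `X̂' ×_T T' → X̂'` (kernel-pair agreement = ★ ed. 2 `restrict_comp_eq_of_isBaseChangeVia` with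
  `u₁ = u₂ = c`) to `G`, `Ĝ` exhibiting `P'` as the pull-back of `P` along `f` (★ `isBaseChangeVia_of_flat_surjective`).
* **`exists_isBaseChangeVia_of_isBaseChangeVia_of_flat_surjective`** — the same with ANY triple `P''` over `T'` that is a
  pull-back of `P'` along `c` in place of the chosen `P'|_{T'}` (★ `exists_isBaseChangeVia_id_of_isBaseChangeVia`): the
  shape (b3) reads with `T' := T ×_Q M`.
* §3 CLASSIFYING DATA (the base map glued / descended TOGETHER with the comparison maps):
  `exists_isBaseChangeVia_of_openCover_of_comp_eq` — the Zariski (8e)-adapter ([MumfordFogartyKirwan1994] Prop. 7.6 with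
  SGA-descent replaced by Zariski gluing: chartwise classifying maps `fᵢ : Uᵢ → S` agreeing on overlaps glue by Mathlib
  `Scheme.Cover.glueMorphisms`, the comparison maps by ★ `exists_isBaseChangeVia_of_openCover`);
  `exists_isBaseChangeVia_of_flat_surjective_of_comp_eq`, `exists_isBaseChangeVia_of_isBaseChangeVia_of_flat_surjective_of_comp_eq`
  — the fpqc JOINT head of F-10 (b2)+(b2′): `f̃ : T' → S` coequalising the kernel pair of `c` descends (★ (δ)
  `exists_desc_of_pullback_comp_eq`) and the comparison maps with it.

## References
* [MumfordFogartyKirwan1994] D. Mumford, J. Fogarty, F. Kirwan, *Geometric Invariant Theory*, 3rd ed. (1994), Ch. 7 §2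
  Definition 7.2 (p. 129); Proposition 7.6 (pp. 136–138).
* [Deligne1971TravauxShimura] P. Deligne, *Travaux de Shimura*, Sém. Bourbaki 389 (1971), 4.16 (p. 150).
* [GortzWedhorn2020] U. Görtz, T. Wedhorn, *Algebraic Geometry I*, 2nd ed. (2020), Section (3.3) Proposition 3.5 (gluing of
  morphisms); Thm. 14.72 (fpqc descent of morphisms).
-/

noncomputable section

-- the `Over`-category structure maps of ★ `baseChange` are not reducible (as in ★ ed. 1).
set_option backward.isDefEq.respectTransparency false

universe u

open CategoryTheory CategoryTheory.Limits AlgebraicGeometry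

namespace Literature.AlgebraicGeometry.AbelianSchemes

open Literature.AlgebraicGeometry.Morphisms

namespace PolarizedAbelianSchemeWithLevel

open AbelianSchemeOver

variable {g N : ℕ} {δ : Fin g → ℕ} {S T T' : Scheme.{u}} {P' : PolarizedAbelianSchemeWithLevel g N δ T}
  {P : PolarizedAbelianSchemeWithLevel g N δ S} {f : T ⟶ S} [IsLocallyNoetherian T]
  (hT : ∀ ⦃Ω : Type u⦄ [Field Ω] [IsAlgClosed Ω] (_t : Spec (.of Ω) ⟶ T)
    (Q : PolarizedAbelianSchemeWithLevel g N δ (Spec (.of Ω))) (H : Q.A.X.left ⟶ Q.A.X.left)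
    (Ĥ : Q.D.hat.X.left ⟶ Q.D.hat.X.left), Q.IsBaseChangeVia Q (𝟙 _) H Ĥ → H = 𝟙 _)
  (c : T' ⟶ T) [Flat c] [Surjective c] [QuasiCompact c] [IsLocallyNoetherian (pullback c c)]

include hT

/-- **PULL-BACK DATA DESCEND ALONG fpqc COVERINGS** ([MumfordFogartyKirwan1994] Prop. 7.6: for `n ≥ 3` pull-back data of
triples are unique, hence descend; [GortzWedhorn2020] Thm. 14.72).  Over a locally Noetherian `T` with rigid geometric
fibres and an fpqc covering `c : T' → T` with `T' ×_T T'` locally Noetherian: if `(G', Ĝ')` exhibit `P'|_{T'}` (★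
`baseChange c`) as the pull-back of `P` along `T' → T → S`, then there are `G : X' → X`, `Ĝ : X̂' → X̂` with
`(X' ×_T T' → X') ≫ G = G'`, `(X̂' ×_T T' → X̂') ≫ Ĝ = Ĝ'` exhibiting `P'` as the pull-back of `P` along `f`: `G'`,
`Ĝ'` coequalise the kernel pairs of the fpqc coverings `X' ×_T T' → X'`, `X̂' ×_T T' → X̂'` (★
`restrict_comp_eq_of_isBaseChangeVia` at `u₁ = u₂ = c`), so they descend (★ `exists_desc_of_pullback_comp_eq`), and the
relation is fpqc-local (★ `isBaseChangeVia_of_flat_surjective`). [cite: MumfordFogartyKirwan1994, Ch. 7 §2 Proposition 7.6 (pp. 136–138)]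
[cite: GortzWedhorn2020, Thm. 14.72] [cite: Deligne1971TravauxShimura, 4.16 p. 150] -/
theorem exists_isBaseChangeVia_of_flat_surjective (Gc : (P'.baseChange c).A.X.left ⟶ P.A.X.left)
    (Ĝc : (P'.baseChange c).D.hat.X.left ⟶ P.D.hat.X.left) (h : (P'.baseChange c).IsBaseChangeVia P (c ≫ f) Gc Ĝc) :
    ∃ (G : P'.A.X.left ⟶ P.A.X.left) (Ĝ : P'.D.hat.X.left ⟶ P.D.hat.X.left),
      pullback.fst P'.A.X.hom c ≫ G = Gc ∧ pullback.fst P'.D.hat.X.hom c ≫ Ĝ = Ĝc ∧ P'.IsBaseChangeVia P f G Ĝ := by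
  obtain ⟨hA, hAh⟩ := restrict_comp_eq_of_isBaseChangeVia (P := P) hT c c h h
  obtain ⟨G, hG⟩ := exists_desc_of_pullback_comp_eq (pullback.fst P'.A.X.hom c) Gc hA
  obtain ⟨Ĝ, hĜ⟩ := exists_desc_of_pullback_comp_eq (pullback.fst P'.D.hat.X.hom c) Ĝc hAh
  refine ⟨G, Ĝ, hG, hĜ, isBaseChangeVia_of_flat_surjective c ?_⟩
  rw [hG, hĜ]
  exact h

/-- **The same from ANY pull-back `P''` of `P'` along `c`** (not only the chosen `P'|_{T'}`): if `(Gc, Ĝc)` exhibit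
`P''/T'` as the pull-back of `P'` along `c` and `(G'', Ĝ'')` exhibit `P''` as the pull-back of `P` along `c ≫ f`, then
there are `G`, `Ĝ` with `Gc ≫ G = G''`, `Ĝc ≫ Ĝ = Ĝ''` exhibiting `P'` as the pull-back of `P` along `f` (compare `P''`
with `P'|_{T'}` by ★ `exists_isBaseChangeVia_id_of_isBaseChangeVia`, compose by ★ `IsBaseChangeVia.trans`, then
`exists_isBaseChangeVia_of_flat_surjective`).  The shape read by F-10 (b3) with `T' := T ×_Q M`.
[cite: MumfordFogartyKirwan1994, Ch. 7 §2 Proposition 7.6 (pp. 136–138)] [cite: MumfordFogartyKirwan1994, Ch. 7 §2 Definition 7.2 (p. 129)]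
[cite: GortzWedhorn2020, Thm. 14.72] -/
theorem exists_isBaseChangeVia_of_isBaseChangeVia_of_flat_surjective {P'' : PolarizedAbelianSchemeWithLevel g N δ T'}
    {Gc : P''.A.X.left ⟶ P'.A.X.left} {Ĝc : P''.D.hat.X.left ⟶ P'.D.hat.X.left} (hc : P''.IsBaseChangeVia P' c Gc Ĝc)
    {G'' : P''.A.X.left ⟶ P.A.X.left} {Ĝ'' : P''.D.hat.X.left ⟶ P.D.hat.X.left}
    (h : P''.IsBaseChangeVia P (c ≫ f) G'' Ĝ'') :
    ∃ (G : P'.A.X.left ⟶ P.A.X.left) (Ĝ : P'.D.hat.X.left ⟶ P.D.hat.X.left),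
      Gc ≫ G = G'' ∧ Ĝc ≫ Ĝ = Ĝ'' ∧ P'.IsBaseChangeVia P f G Ĝ := by
  obtain ⟨H, Ĥ, hHi, hĤi, hHG, hĤG, hK⟩ :=
    hc.exists_isBaseChangeVia_id_of_isBaseChangeVia (P'.baseChange_isBaseChangeVia c)
  have h₁ := hK.trans h
  rw [Category.id_comp] at h₁
  obtain ⟨G, Ĝ, hG, hĜ, hrel⟩ := exists_isBaseChangeVia_of_flat_surjective (P := P) hT c _ _ h₁
  refine ⟨G, Ĝ, ?_, ?_, hrel⟩
  · rw [← cancel_epi H, ← Category.assoc, hHG, hG]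
  · rw [← cancel_epi Ĥ, ← Category.assoc, hĤG, hĜ]

/-! ### §3 Classifying data: the base map glued / descended together with the comparison maps -/

/-- **CHARTWISE CLASSIFYING DATA GLUE** (F-8 (8e), [MumfordFogartyKirwan1994] Prop. 7.6 with Zariski gluing): over a locally
Noetherian `T` with rigid geometric fibres, chartwise `fᵢ : Uᵢ → S` agreeing on the overlaps `Uᵢ ×_T Uⱼ` and chartwise
`(Gᵢ, Ĝᵢ)` exhibiting `P'|_{Uᵢ}` as the pull-back of `P` along `fᵢ` glue to `f : T → S` (Mathlib
`Scheme.Cover.glueMorphisms`, [GortzWedhorn2020] Prop. 3.5) and `(G, Ĝ)` exhibiting `P'` as the pull-back of `P` along `f`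
(★ `exists_isBaseChangeVia_of_openCover`). [cite: MumfordFogartyKirwan1994, Ch. 7 §2 Proposition 7.6 (pp. 136–138)]
[cite: GortzWedhorn2020, Section (3.3) Proposition 3.5] -/
theorem exists_isBaseChangeVia_of_openCover_of_comp_eq (𝒰 : Scheme.OpenCover.{u} T) (fc : ∀ i, 𝒰.X i ⟶ S)
    (hf : ∀ i j, pullback.fst (𝒰.f i) (𝒰.f j) ≫ fc i = pullback.snd (𝒰.f i) (𝒰.f j) ≫ fc j)
    (Gc : ∀ i, (P'.baseChange (𝒰.f i)).A.X.left ⟶ P.A.X.left)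
    (Ĝc : ∀ i, (P'.baseChange (𝒰.f i)).D.hat.X.left ⟶ P.D.hat.X.left)
    (h : ∀ i, (P'.baseChange (𝒰.f i)).IsBaseChangeVia P (fc i) (Gc i) (Ĝc i)) :
    ∃ (f : T ⟶ S) (G : P'.A.X.left ⟶ P.A.X.left) (Ĝ : P'.D.hat.X.left ⟶ P.D.hat.X.left),
      (∀ i, 𝒰.f i ≫ f = fc i) ∧ (∀ i, pullback.fst P'.A.X.hom (𝒰.f i) ≫ G = Gc i) ∧
        (∀ i, pullback.fst P'.D.hat.X.hom (𝒰.f i) ≫ Ĝ = Ĝc i) ∧ P'.IsBaseChangeVia P f G Ĝ := by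
  have hfi : ∀ i, 𝒰.f i ≫ Scheme.Cover.glueMorphisms 𝒰 fc hf = fc i := Scheme.Cover.ι_glueMorphisms 𝒰 fc hf
  obtain ⟨G, Ĝ, hG, hĜ, hrel⟩ := exists_isBaseChangeVia_of_openCover (P := P) (f := Scheme.Cover.glueMorphisms 𝒰 fc hf)
    hT 𝒰 Gc Ĝc fun i => by rw [hfi i]; exact h i
  exact ⟨_, G, Ĝ, hfi, hG, hĜ, hrel⟩

/-- **CLASSIFYING DATA DESCEND ALONG fpqc COVERINGS** (F-10 (b2)+(b2′) jointly): for an fpqc covering `c : T' → T` with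
`T' ×_T T'` locally Noetherian, a map `f̃ : T' → S` coequalising the kernel pair of `c` and `(G', Ĝ')` exhibiting `P'|_{T'}`
as the pull-back of `P` along `f̃`, there are `f : T → S` with `c ≫ f = f̃` (★ `exists_desc_of_pullback_comp_eq`,
[GortzWedhorn2020] Thm. 14.72) and `(G, Ĝ)` restricting to `(G', Ĝ')` exhibiting `P'` as the pull-back of `P` along `f` (★
`exists_isBaseChangeVia_of_flat_surjective`). [cite: GortzWedhorn2020, Thm. 14.72] [cite: MumfordFogartyKirwan1994, Ch. 7 §2 Proposition 7.6 (pp. 136–138)] -/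
theorem exists_isBaseChangeVia_of_flat_surjective_of_comp_eq (fc : T' ⟶ S)
    (hf : pullback.fst c c ≫ fc = pullback.snd c c ≫ fc) (Gc : (P'.baseChange c).A.X.left ⟶ P.A.X.left)
    (Ĝc : (P'.baseChange c).D.hat.X.left ⟶ P.D.hat.X.left) (h : (P'.baseChange c).IsBaseChangeVia P fc Gc Ĝc) :
    ∃ (f : T ⟶ S) (G : P'.A.X.left ⟶ P.A.X.left) (Ĝ : P'.D.hat.X.left ⟶ P.D.hat.X.left),
      c ≫ f = fc ∧ pullback.fst P'.A.X.hom c ≫ G = Gc ∧ pullback.fst P'.D.hat.X.hom c ≫ Ĝ = Ĝc ∧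
        P'.IsBaseChangeVia P f G Ĝ := by
  obtain ⟨f, hfc⟩ := exists_desc_of_pullback_comp_eq c fc hf
  obtain ⟨G, Ĝ, hG, hĜ, hrel⟩ := exists_isBaseChangeVia_of_flat_surjective (P := P) (f := f) hT c Gc Ĝc
    (by rw [hfc]; exact h)
  exact ⟨f, G, Ĝ, hfc, hG, hĜ, hrel⟩

/-- **The same from ANY pull-back `P''/T'` of `P'` along `c`** (★
`exists_isBaseChangeVia_of_isBaseChangeVia_of_flat_surjective`): `(Gc, Ĝc)` exhibit `P''` as the pull-back of `P'`
along `c`, `(G'', Ĝ'')` exhibit `P''` as the pull-back of `P` along `f̃ : T' → S` coequalising the kernel pair of `c`; then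
`f̃` descends to `f : T → S` and `P'` is the pull-back of `P` along `f` via `(G, Ĝ)` with `Gc ≫ G = G''`, `Ĝc ≫ Ĝ = Ĝ''`.
[cite: GortzWedhorn2020, Thm. 14.72] [cite: MumfordFogartyKirwan1994, Ch. 7 §2 Proposition 7.6 (pp. 136–138)] -/
theorem exists_isBaseChangeVia_of_isBaseChangeVia_of_flat_surjective_of_comp_eq
    {P'' : PolarizedAbelianSchemeWithLevel g N δ T'} {Gc : P''.A.X.left ⟶ P'.A.X.left}
    {Ĝc : P''.D.hat.X.left ⟶ P'.D.hat.X.left} (hc : P''.IsBaseChangeVia P' c Gc Ĝc) (fc : T' ⟶ S)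
    (hf : pullback.fst c c ≫ fc = pullback.snd c c ≫ fc) {G'' : P''.A.X.left ⟶ P.A.X.left}
    {Ĝ'' : P''.D.hat.X.left ⟶ P.D.hat.X.left} (h : P''.IsBaseChangeVia P fc G'' Ĝ'') :
    ∃ (f : T ⟶ S) (G : P'.A.X.left ⟶ P.A.X.left) (Ĝ : P'.D.hat.X.left ⟶ P.D.hat.X.left),
      c ≫ f = fc ∧ Gc ≫ G = G'' ∧ Ĝc ≫ Ĝ = Ĝ'' ∧ P'.IsBaseChangeVia P f G Ĝ := by
  obtain ⟨f, hfc⟩ := exists_desc_of_pullback_comp_eq c fc hf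
  obtain ⟨G, Ĝ, hG, hĜ, hrel⟩ := exists_isBaseChangeVia_of_isBaseChangeVia_of_flat_surjective (P := P) (f := f) hT c hc
    (G'' := G'') (Ĝ'' := Ĝ'') (by rw [hfc]; exact h)
  exact ⟨f, G, Ĝ, hfc, hG, hĜ, hrel⟩

end PolarizedAbelianSchemeWithLevel

end Literature.AlgebraicGeometry.AbelianSchemes

end
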